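import Mathlib
import HarnessLib
import Literature.Probability.MarkovChains.GlauberDynamics

/-!
# Glauber dynamics for the Ising model: `p(σ,w) = e^{βS}/(e^{βS} + e^{−βS}) = (1 + tanh βS)/2` (Levin–Peres–Wilmer §3.3.5)

HONEST FRAMING: exact (Metropolis-corrected) sampling algorithms for lattice gauge theory; figures
of merit are autocorrelation/cost numbers at stated couplings and volumes; no continuum-physics claim.

Continues `GlauberDynamics.lean` (`AgreeOff`, `siteMass`, `glauberSiteLaw`, `glauberKernel`, with
reversibility / stationarity / irreducibility for positive `π`) in the conventions of
`MetropolisHastings.lean` (`IsStationary`, `DetailedBalance`) and `PeskunOrdering.lean`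
(`IsIrreducible`).  Source: D. A. Levin, Y. Peres (with E. L. Wilmer), *Markov Chains and Mixing
Times*, 2nd ed., AMS 2017 [LevinPeres2017], §3.3.5 "Ising model", pp. 44–45, eqs. (3.8)–(3.12).
Everything is PROVED (finite sums; 0 named facts).

Spins are `σ : V → ℤˣ` (`X = {−1,1}^V`) on the vertex set of a finite simple graph `G`.

* `localSpinSum G σ w` — **`S(σ,w) = Σ_{u ∼ w} σ(u)`** [cite: LevinPeres2017, §3.3.5 eq. (3.11)
  (definition of `S(σ,w)`)]; `isingEnergy G σ` — **eq. (3.8)** `H(σ) = −Σ_{v∼w} σ(v)σ(w)` (the sum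
  over edges, written as `−½ Σ_v Σ_u 1{v∼u} σ(v)σ(u)`); `isingZ`, `gibbsLaw G β` — **eqs. (3.9)–(3.10)**
  `μ(σ) = e^{−βH(σ)}/Z(β)` [cite: LevinPeres2017, §3.3.5 eqs. (3.8)–(3.10)]; `gibbsLaw_pos`,
  `sum_gibbsLaw`;
* `isingEnergy_update_sub` — flipping the spin at `w`: `H(σ^{w←s}) − H(σ^{w←s'}) = −(s − s')S(σ,w)`;
* `siteMass_eq_sum_update` — for single-site dynamics `π(X(x,v)) = Σ_s π(x^{v←s})` (the class
  `X(x,v)` of (3.6) is the set of single-site modifications of `x`);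
* **EQ. (3.11)** `LevinPeres2017_eq_3_11` — the conditional `μ`-probability of spin `+1` at `w` is
  **`p(σ,w) = e^{βS(σ,w)}/(e^{βS(σ,w)} + e^{−βS(σ,w)}) = (1 + tanh(βS(σ,w)))/2`**; more generally
  `glauberSiteLaw_gibbsLaw_update`: spin `s` is drawn with probability `e^{βsS}/(e^{βsS} + e^{−βsS})`
  [cite: LevinPeres2017, §3.3.5 eq. (3.11)];
* **EQ. (3.12)** `LevinPeres2017_eq_3_12` — the transition matrix
  `P(σ,σ') = |V|⁻¹ Σ_w [e^{βσ'(w)S(σ,w)}/(e^{βσ'(w)S(σ,w)} + e^{−βσ'(w)S(σ,w)})] 1{σ(v) = σ'(v) for v ≠ w}`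
  [cite: LevinPeres2017, §3.3.5 eq. (3.12)] and `isingGlauber_isStationary` — "this chain has
  stationary distribution given by the Gibbs distribution `μ`" (indeed reversible and irreducible:
  `isingGlauber_detailedBalance`, `isingGlauber_isIrreducible`) [cite: LevinPeres2017, §3.3.5
  (sentence after eq. (3.12))].

Context (cell pub-lqcd, venture LatticeQCDFlow): this is the heat-bath algorithm for the Ising model,
the `ℤ₂` prototype of the heat-bath link update of lattice gauge theory; the file certifies its
exactness (`μ` stationary) from the explicit update probability.
-/

namespace Literature.Probability.MarkovChains

open Finset Matrix Function

variable {V : Type*} [Fintype V] [DecidableEq V] (G : SimpleGraph V) [DecidableRel G.Adj]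

/-! ## The Ising model: `S(σ,w)`, `H(σ)`, `Z(β)`, `μ` -/

/-- **`S(σ,w) := Σ_{u : u ∼ w} σ(u)`**, the sum of the spins adjacent to `w`.
[cite: LevinPeres2017, §3.3.5 eq. (3.11) (definition of `S(σ,w)`)] -/
def localSpinSum (σ : V → ℤˣ) (w : V) : ℝ := ∑ u, if G.Adj w u then ((σ u : ℤ) : ℝ) else 0

/-- **Eq. (3.8)**: the Ising energy `H(σ) = −Σ_{v,w ∈ V, v ∼ w} σ(v)σ(w)` (each edge once), written as
`−½ Σ_v Σ_u 1{v ∼ u} σ(v)σ(u)` over ordered pairs. [cite: LevinPeres2017, §3.3.5 eq. (3.8)] -/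
noncomputable def isingEnergy (σ : V → ℤˣ) : ℝ :=
  -(1 / 2) * ∑ v, ∑ u, if G.Adj v u then ((σ v : ℤ) : ℝ) * ((σ u : ℤ) : ℝ) else 0

/-- **Eq. (3.10)**: the partition function `Z(β) = Σ_σ e^{−βH(σ)}`. [cite: LevinPeres2017, §3.3.5
eq. (3.10)] -/
noncomputable def isingZ (β : ℝ) : ℝ := ∑ σ : V → ℤˣ, Real.exp (-β * isingEnergy G σ)

/-- **Eq. (3.9)**: the Gibbs distribution `μ(σ) = e^{−βH(σ)}/Z(β)`. [cite: LevinPeres2017, §3.3.5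
eq. (3.9)] -/
noncomputable def gibbsLaw (β : ℝ) (σ : V → ℤˣ) : ℝ := Real.exp (-β * isingEnergy G σ) / isingZ G β

variable {G}

/-- `Z(β) > 0`. [cite: LevinPeres2017, §3.3.5 eq. (3.10) ("the normalizing constant required to make
`μ` a probability distribution")] -/
theorem isingZ_pos (β : ℝ) : 0 < isingZ G β := by
  unfold isingZ
  haveI : Nonempty (V → ℤˣ) := ⟨fun _ => 1⟩
  exact sum_pos (fun σ _ => Real.exp_pos _) univ_nonempty

/-- `μ(σ) > 0`. [cite: LevinPeres2017, §3.3.5 eq. (3.9)] -/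
theorem gibbsLaw_pos (β : ℝ) (σ : V → ℤˣ) : 0 < gibbsLaw G β σ :=
  div_pos (Real.exp_pos _) (isingZ_pos β)

/-- `Σ_σ μ(σ) = 1`. [cite: LevinPeres2017, §3.3.5 eqs. (3.9)–(3.10)] -/
theorem sum_gibbsLaw (β : ℝ) : ∑ σ : V → ℤˣ, gibbsLaw G β σ = 1 := by
  unfold gibbsLaw
  rw [← sum_div]
  exact div_self (isingZ_pos β).ne'

/-! ## Flipping one spin -/

/-- **The energy change of a single-site modification**: `H(σ^{w←s}) − H(σ^{w←s'}) = −(s − s')S(σ,w)`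
(only the edges at `w` contribute, each once). [cite: LevinPeres2017, §3.3.5 eqs. (3.8), (3.11) ("the
conditional `μ`-probability of spin `+1` at `w` … depends only on the spins at vertices adjacent to
`w`")] -/
theorem isingEnergy_update_sub (σ : V → ℤˣ) (w : V) (s s' : ℤˣ) :
    isingEnergy G (update σ w s) - isingEnergy G (update σ w s') =
      -(((s : ℤ) : ℝ) - ((s' : ℤ) : ℝ)) * localSpinSum G σ w := by
  unfold isingEnergy localSpinSum
  -- termwise difference of the double sums
  have hterm : ∀ v u : V,
      ((if G.Adj v u then ((update σ w s v : ℤ) : ℝ) * ((update σ w s u : ℤ) : ℝ) else 0) -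
        (if G.Adj v u then ((update σ w s' v : ℤ) : ℝ) * ((update σ w s' u : ℤ) : ℝ) else 0)) =
      (if v = w then (if G.Adj w u then (((s : ℤ) : ℝ) - ((s' : ℤ) : ℝ)) * ((σ u : ℤ) : ℝ) else 0)
        else 0) +
      (if u = w then (if G.Adj v w then (((s : ℤ) : ℝ) - ((s' : ℤ) : ℝ)) * ((σ v : ℤ) : ℝ) else 0)
        else 0) := by
    intro v u
    by_cases hv : v = w
    · subst hv
      by_cases hu : u = v
      · subst hu
        simp [SimpleGraph.irrefl]
      · rw [if_pos rfl, if_neg hu, update_self, update_self, update_of_ne hu, update_of_ne hu,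
          add_zero]
        split_ifs <;> ring
    · rw [if_neg hv, zero_add, update_of_ne hv, update_of_ne hv]
      by_cases hu : u = w
      · subst hu
        rw [if_pos rfl, update_self, update_self]
        split_ifs <;> ring
      · rw [if_neg hu, update_of_ne hu, update_of_ne hu, sub_self]
  rw [← mul_sub, ← sum_sub_distrib]
  simp_rw [← sum_sub_distrib, hterm, sum_add_distrib]
  have hA : ∑ v, ∑ u, (if v = w then
      (if G.Adj w u then (((s : ℤ) : ℝ) - ((s' : ℤ) : ℝ)) * ((σ u : ℤ) : ℝ) else 0) else 0) =
      ∑ u, (if G.Adj w u then (((s : ℤ) : ℝ) - ((s' : ℤ) : ℝ)) * ((σ u : ℤ) : ℝ) else 0) := by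
    rw [sum_comm]
    refine sum_congr rfl fun u _ => ?_
    simp only [sum_ite_eq', mem_univ, if_true]
  have hB : ∑ v, ∑ u, (if u = w then
      (if G.Adj v w then (((s : ℤ) : ℝ) - ((s' : ℤ) : ℝ)) * ((σ v : ℤ) : ℝ) else 0) else 0) =
      ∑ v, (if G.Adj v w then (((s : ℤ) : ℝ) - ((s' : ℤ) : ℝ)) * ((σ v : ℤ) : ℝ) else 0) := by
    refine sum_congr rfl fun v _ => ?_
    simp only [sum_ite_eq', mem_univ, if_true]
  rw [hA, hB]
  have hsymm : ∀ v, (if G.Adj v w then (((s : ℤ) : ℝ) - ((s' : ℤ) : ℝ)) * ((σ v : ℤ) : ℝ) else 0) =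
      (if G.Adj w v then (((s : ℤ) : ℝ) - ((s' : ℤ) : ℝ)) * ((σ v : ℤ) : ℝ) else 0) := fun v => by
    simp_rw [G.adj_comm]
  simp_rw [hsymm, ← sum_add_distrib, ← two_mul, ← mul_sum]
  have hfac : ∀ u, (if G.Adj w u then (((s : ℤ) : ℝ) - ((s' : ℤ) : ℝ)) * ((σ u : ℤ) : ℝ) else 0) =
      (((s : ℤ) : ℝ) - ((s' : ℤ) : ℝ)) * (if G.Adj w u then ((σ u : ℤ) : ℝ) else 0) := fun u => by
    split_ifs <;> ring
  simp_rw [hfac, ← mul_sum]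
  ring

/-! ## The conditional law at one site -/

omit [Fintype V] [DecidableRel G.Adj] in
/-- A configuration agreeing with `x` off `v` is the single-site modification `x^{v ← y(v)}`.
[cite: LevinPeres2017, §3.3.2 eq. (3.6)] -/
theorem AgreeOff.eq_update {S : Type*} {x y : V → S} {v : V} (h : AgreeOff x v y) :
    y = update x v (y v) := by
  funext w
  by_cases hw : w = v
  · subst hw
    rw [update_self]
  · rw [update_of_ne hw, h w hw]

omit [DecidableRel G.Adj] in
/-- **`π(X(x,v)) = Σ_s π(x^{v←s})`**: the class `X(x,v)` consists of the single-site modifications of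
`x` at `v`. [cite: LevinPeres2017, §3.3.2 eqs. (3.6)–(3.7)] -/
theorem siteMass_eq_sum_update {S : Type*} [Fintype S] [DecidableEq S] (π : (V → S) → ℝ)
    (x : V → S) (v : V) : siteMass π x v = ∑ s : S, π (update x v s) := by
  unfold siteMass
  have hset : univ.filter (AgreeOff x v) = univ.image (update x v) := by
    ext y
    simp only [mem_filter, mem_univ, true_and, mem_image]
    constructor
    · intro h
      exact ⟨y v, h.eq_update.symm⟩
    · rintro ⟨s, rfl⟩
      exact agreeOff_update x v s
  rw [hset, sum_image fun s _ s' _ h => update_injective x v h]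

/-- Sums over `ℤˣ = {1, −1}`. [cite: LevinPeres2017, §3.3.5 (`X = {−1,1}^V`)] -/
theorem sum_units_int (f : ℤˣ → ℝ) : ∑ s : ℤˣ, f s = f 1 + f (-1) := by
  have huniv : (univ : Finset ℤˣ) = {1, -1} := by
    ext u
    simp only [mem_univ, mem_insert, mem_singleton, true_iff]
    exact Int.units_eq_one_or u
  rw [huniv, sum_pair (by decide)]

/-- `e^A/(e^A + e^B) = e^c/(e^c + e^{−c})` when `A − B = 2c`. [cite: LevinPeres2017, §3.3.5 eq. (3.11)
("The reader can check that …")] -/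
theorem exp_div_exp_add_exp {A B c : ℝ} (h : A - B = 2 * c) :
    Real.exp A / (Real.exp A + Real.exp B) = Real.exp c / (Real.exp c + Real.exp (-c)) := by
  have hA : A = B + c + c := by linarith
  rw [hA, Real.exp_add, Real.exp_add, Real.exp_neg]
  have hB := Real.exp_pos B
  have hc := Real.exp_pos c
  field_simp

/-- **The Ising heat-bath probabilities**: under the Glauber dynamics for `μ`, the spin at `w` is
resampled to `s` with probability `e^{βsS(σ,w)}/(e^{βsS(σ,w)} + e^{−βsS(σ,w)})` (`s = ±1`).
[cite: LevinPeres2017, §3.3.5 eqs. (3.11)–(3.12)] -/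
theorem glauberSiteLaw_gibbsLaw_update (β : ℝ) (σ : V → ℤˣ) (w : V) (s : ℤˣ) :
    glauberSiteLaw (gibbsLaw G β) σ w (update σ w s) =
      Real.exp (β * ((s : ℤ) : ℝ) * localSpinSum G σ w) /
        (Real.exp (β * ((s : ℤ) : ℝ) * localSpinSum G σ w) +
          Real.exp (-(β * ((s : ℤ) : ℝ) * localSpinSum G σ w))) := by
  rw [glauberSiteLaw_of_agreeOff (agreeOff_update σ w s), siteMass_eq_sum_update, sum_units_int]
  unfold gibbsLaw
  have hZ := (isingZ_pos (G := G) β).ne'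
  rw [← add_div, div_div_div_cancel_right₀ hZ]
  -- `s = 1` or `s = −1`
  rcases Int.units_eq_one_or s with rfl | rfl
  · refine exp_div_exp_add_exp ?_
    have h := isingEnergy_update_sub (G := G) σ w 1 (-1)
    push_cast at h ⊢
    linear_combination (-β) * h
  · rw [add_comm (Real.exp (-β * isingEnergy G (update σ w 1)))]
    refine exp_div_exp_add_exp ?_
    have h := isingEnergy_update_sub (G := G) σ w (-1) 1
    push_cast at h ⊢
    linear_combination (-β) * h

/-- **EQ. (3.11)**: the conditional `μ`-probability of spin `+1` at `w` is
**`p(σ,w) = e^{βS(σ,w)}/(e^{βS(σ,w)} + e^{−βS(σ,w)}) = (1 + tanh(βS(σ,w)))/2`**.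
[cite: LevinPeres2017, §3.3.5 eq. (3.11)] -/
theorem LevinPeres2017_eq_3_11 (β : ℝ) (σ : V → ℤˣ) (w : V) :
    glauberSiteLaw (gibbsLaw G β) σ w (update σ w 1) =
      Real.exp (β * localSpinSum G σ w) /
        (Real.exp (β * localSpinSum G σ w) + Real.exp (-(β * localSpinSum G σ w))) ∧
    Real.exp (β * localSpinSum G σ w) /
        (Real.exp (β * localSpinSum G σ w) + Real.exp (-(β * localSpinSum G σ w))) =
      (1 + Real.tanh (β * localSpinSum G σ w)) / 2 := by
  constructor
  · have h := glauberSiteLaw_gibbsLaw_update (G := G) β σ w 1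
    simpa using h
  · rw [Real.tanh_eq_sinh_div_cosh, Real.sinh_eq, Real.cosh_eq]
    have h1 := Real.exp_pos (β * localSpinSum G σ w)
    have h2 := Real.exp_pos (-(β * localSpinSum G σ w))
    field_simp
    ring

/-- **EQ. (3.12)**, one site: for `σ'` agreeing with `σ` off `w`, the Glauber dynamics resamples the
spin at `w` to `σ'(w)` with probability `e^{βσ'(w)S(σ,w)}/(e^{βσ'(w)S(σ,w)} + e^{−βσ'(w)S(σ,w)})`.
[cite: LevinPeres2017, §3.3.5 eq. (3.12)] -/
theorem glauberSiteLaw_gibbsLaw_of_agreeOff (β : ℝ) {σ σ' : V → ℤˣ} {w : V} (h : AgreeOff σ w σ') :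
    glauberSiteLaw (gibbsLaw G β) σ w σ' =
      Real.exp (β * ((σ' w : ℤ) : ℝ) * localSpinSum G σ w) /
        (Real.exp (β * ((σ' w : ℤ) : ℝ) * localSpinSum G σ w) +
          Real.exp (-(β * ((σ' w : ℤ) : ℝ) * localSpinSum G σ w))) := by
  conv_lhs => rw [h.eq_update]
  rw [glauberSiteLaw_gibbsLaw_update]

/-- **EQ. (3.12)**: the transition matrix of the Glauber dynamics for the Ising Gibbs distribution,
`P(σ,σ') = |V|⁻¹ Σ_w [e^{βσ'(w)S(σ,w)}/(e^{βσ'(w)S(σ,w)} + e^{−βσ'(w)S(σ,w)})]·1{σ(v) = σ'(v) for v ≠ w}`.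
[cite: LevinPeres2017, §3.3.5 eq. (3.12)] -/
theorem LevinPeres2017_eq_3_12 (β : ℝ) (σ σ' : V → ℤˣ) :
    glauberKernel (gibbsLaw G β) σ σ' = (Fintype.card V : ℝ)⁻¹ * ∑ w,
      if AgreeOff σ w σ' then
        Real.exp (β * ((σ' w : ℤ) : ℝ) * localSpinSum G σ w) /
          (Real.exp (β * ((σ' w : ℤ) : ℝ) * localSpinSum G σ w) +
            Real.exp (-(β * ((σ' w : ℤ) : ℝ) * localSpinSum G σ w)))
      else 0 := by
  rw [glauberKernel_apply]
  congr 1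
  refine sum_congr rfl fun w _ => ?_
  by_cases h : AgreeOff σ w σ'
  · rw [if_pos h, glauberSiteLaw_gibbsLaw_of_agreeOff β h]
  · rw [if_neg h]
    exact if_neg h

/-! ## Exactness: `μ` is stationary (indeed reversible), and the dynamics is irreducible -/

/-- **"This chain has stationary distribution given by the Gibbs distribution `μ`."**
[cite: LevinPeres2017, §3.3.5 (sentence after eq. (3.12))] -/
theorem isingGlauber_isStationary [Nonempty V] (β : ℝ) :
    IsStationary (gibbsLaw G β) (glauberKernel (gibbsLaw G β)) :=
  glauberKernel_isStationary (gibbsLaw_pos β)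

/-- The Ising Glauber dynamics is reversible with respect to `μ`. [cite: LevinPeres2017, §3.3.2
("always stationary and reversible"), §3.3.5] -/
theorem isingGlauber_detailedBalance (β : ℝ) :
    DetailedBalance (gibbsLaw G β) (glauberKernel (gibbsLaw G β)) :=
  glauberKernel_detailedBalance _

/-- The Ising Glauber dynamics is irreducible on `{−1,1}^V`. [cite: LevinPeres2017, §3.3.5 with §1.3
(irreducibility)] -/
theorem isingGlauber_isIrreducible [Nonempty V] (β : ℝ) :
    IsIrreducible (glauberKernel (gibbsLaw G β)) :=
  glauberKernel_isIrreducible (gibbsLaw_pos β)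

end Literature.Probability.MarkovChains
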